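import Summits.Langlands.Langlands.Statement
import Literature.NumberTheory.Automorphic.AutomorphicInductionUnitaryCharacterCubic
import Literature.NumberTheory.Automorphic.IsAutomorphicAE
import HarnessLib

/-!
# F3 `_special` — the floor is LITERALLY the family at `d = 3` (line `QuarticInducedCharacterReciprocity`, crux
`ReciprocityUpToIrreducibility`, item stmt-Langlands-14328; G4 ladder-down generation 19)

`floor_three : automorphicInduction_unitaryCharacter_cubic → InducedCharacterReciprocity 3` — five lines: clause (1) of
the in-tree named fact (Jacquet–Piatetski-Shapiro–Shalika 1979 via Gelbart 1997 Thm. 5.3.1, `E/F` cubic NOT assumed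
Galois, `θ` any unitary idèle class character, `F` ANY number field) hands over the automorphic `π` of `GL₃(𝔸_F)` with
the induced Satake polynomials; the family's Frobenius hypothesis on `ρ` turns that into `SatakeFrobCompatibleAE ι π ρ`.
Witness regime: ALL number fields (S is not known over any number field) — a calibrated rung (TRIBUNAL-FIT F9 (i)).
No `sorry`.
-/

noncomputable section

set_option linter.dupNamespace false

open scoped MatrixGroups Matrix NumberField Classical Polynomial
open Filter IsDedekindDomain Field Polynomial NumberField
open Literature.NumberTheory.Automorphic Literature.NumberTheory.GaloisRepresentations
open Literature.NumberTheory.PAdicHodge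
open Summit.Langlands

namespace Summit.Langlands.Langlands.Cruxes.ReciprocityUpToIrreducibility.QuarticInducedCharacterReciprocity

/-- **The RUNG FAMILY, dial = induction degree `d = [E:F]`** (verbatim the skeleton's): induced-character
reciprocity along arbitrary degree-`d` extensions (clause (B), a.e. Satake form, on the sector of irreducible geometric
`ρ : Γ_F → GL_d(ℚ̄_ℓ)` whose Frobenius polynomials are the induced polynomials of a unitary Hecke character `θ` of a
degree-`d` extension `E/F`, ANY Galois closure, ANY number field `F`). -/
def InducedCharacterReciprocity (d : ℕ) : Prop :=
  ∀ (F E : Type) [Field F] [NumberField F] [Field E] [NumberField E] [Algebra F E],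
    Module.finrank F E = d →
    ∀ (θ : HeckeCharacter E), θ.IsUnitary →
      ∀ (hF : isCompact_glFiniteIntegralLevel d F) (ℓ : ℕ) [Fact ℓ.Prime] (ι : PadicAlgCl ℓ ≃+* ℂ)
        (ρ : FramedGaloisRep F (PadicAlgCl ℓ) d),
        ρ.toGaloisRep.IsIrreducible →
        (∀ (w : HeightOneSpectrum (𝓞 F)) (hw : ((ℓ : ℕ) : 𝓞 F) ∈ w.asIdeal),
            (fontainePstAdicCompletion w ℓ hw).IsDeRhamFramed (ρ.toLocal w)) →
        (∀ᶠ v : HeightOneSpectrum (𝓞 F) in cofinite, ρ.IsUnramifiedAt v ∧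
            ∀ α : Multiset ℂ, satakePolynomial α =
                ∏ᶠ w ∈ {w : HeightOneSpectrum (𝓞 E) | w.under (𝓞 F) = v},
                  (X ^ w.asIdeal.inertiaDeg (𝓞 F) - C (θ.valueAtUniformizer w)) →
              ρ.HasFrobCharpolyAt v (arithFrobPolyOfSatake ι v.residueCard 1 α)) →
        ∃ π : AutomorphicRepData (AutomorphyDatum.gl d F hF), SatakeFrobCompatibleAE ι π ρ

/-- **THE RUNG (θ21 = 4)**: induced-character reciprocity along ARBITRARY QUARTIC extensions (open core: primitive
quartics, Galois closure `A₄ / S₄`). -/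
def QuarticInducedCharacterReciprocity : Prop := InducedCharacterReciprocity 4

/-- **F3: the family at `d = 3` IS the floor** (JPSS 1979, clause (1) of the in-tree named fact). -/
theorem floor_three (h : automorphicInduction_unitaryCharacter_cubic) : InducedCharacterReciprocity 3 := by
  intro F E _ _ _ _ _ hd θ hθ hF ℓ _ ι ρ _hirr _hdR hfrob
  obtain ⟨π, hπ⟩ := (h F E hd θ hθ hF).1
  refine ⟨π, ?_⟩
  filter_upwards [hπ, hfrob] with v ⟨α, hα, hpoly⟩ ⟨hunr, hfr⟩
  exact ⟨α, hα, hunr, hfr α hpoly⟩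

/-- The instantiation, as the brief asks (`example : Rung θ₀ := … floor`). -/
example (h : automorphicInduction_unitaryCharacter_cubic) : InducedCharacterReciprocity 3 := floor_three h

/-- The degree-zero member is vacuous (`[E:F] ≥ 1`). -/
theorem family_zero : InducedCharacterReciprocity 0 := by
  intro F E _ _ _ _ _ hd
  exact absurd hd (Module.finrank_pos (R := F) (M := E)).ne'

end Summit.Langlands.Langlands.Cruxes.ReciprocityUpToIrreducibility.QuarticInducedCharacterReciprocity

end
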